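import Summits.ResolutionOfSingularities.ResolutionOfSingularities.Theorems.MarkedTransferCampaignW46MohWindowShadeDecrease
import Summits.ResolutionOfSingularities.ResolutionOfSingularities.Theorems.MarkedTransferCampaignW46MohWindowShadeHasse
import Summits.ResolutionOfSingularities.ResolutionOfSingularities.Theorems.MarkedTransferCampaignW46MohWindowShadeCleaning
import Mathlib.Algebra.Polynomial.Roots
import Mathlib.Algebra.Polynomial.Taylor
import HarnessLib

/-!
# [OURS · L1 W4.6] Rung (iii) "Moh window", surfaces — origin runs and ADAPTED states (what a stall does
  to the next state)

Cell `res-hironaka`, rung L, slot W4.6, seat `res-L1-s46-pv-6` (gen 3): lemmas of the TERMINATION half for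
SURFACES in the tree's transcription of [Hauser2010, §§F–G] (`PointBlowup.State/step/shade/ShadeDrops`,
`PointBlowupShade.lean`), walks presented in the Hauser–Wagner frame (translated and horizontal moves read
in the chart of the letter `y_j`, the vertical move at the origin of the chart `y_i`).

* §1 ORIGIN RUNS (all dimensions): at the origin of a chart nothing is translated and nothing is cleaned,
  so a monomial `y^d` of a cleaned `F` of order `≥ p` survives as `y^{d^}` with the same coefficient
  (`coeff_chartExponent_step_origin`), and `|d^| + p = |d| + Σ_{l ≠ c} d_l`.  Hence an INFINITE run of
  blow-ups read at the origin of one and the same chart `y_c`, all of order `≥ p`, forces every monomial of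
  the initial residual polynomial to have `Σ_{l ≠ c} d_l ≥ p` (`forall_le_sum_of_origin_run`) — for two
  letters: `y_{c'}^p ∣ F₀`, the coordinate `p`-fold curve.
* §2 SURFACES, inside the window `p < o < 2p`: a STALL (no drop of the shade `a`) at a point of the chart
  `y_j` makes the next state ADAPTED to `y_j` — its residual polynomial contains the monomial
  `y^{r'}·y_i^{a}` (`exists_adapted_of_stall_origin` from gen 2's decrease law at the origin;
  `exists_adapted_of_stall_translate` at a translated point `t ≠ 0`, by the Hasse test of gen 2 and a count
  of roots: the dehomogenised initial form `P(y) = Σ_{|d| = o} c_d y^{d_i}`, of degree `≤ r_i + a` and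
  divisible by `y^{r_i}`, cannot vanish to order `a + 1` at `t ≠ 0`); and from a state adapted to `y_j` with
  `a ≥ 1` the vertical move (origin of the chart `y_i`) DROPS the shade (`shadeDrops_vertical_of_adapted`):
  after a stall in the chart `y_j`, the walk can only stall again in the chart `y_j`.
OURS; replaces — for regime (iii) of RESCUE-SEED W4.6, the classical pair, surfaces — the ROLE of the
termination clause of Th. 16.13 (ms. p. 87); NOT a statement of the manuscript [claim: Hironaka2017,
status: under-review], nothing of which is used.  AI review is weaker than expert review.
-/

noncomputable section

set_option linter.dupNamespace false -- mandated namespace of this single-conjunct summit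

open MvPolynomial Finset

open scoped BigOperators

namespace Summit.ResolutionOfSingularities.ResolutionOfSingularities.Theorems.CampaignW46.MohWindowShadeAdapted

open Literature.AlgebraicGeometry.Resolution
open Literature.AlgebraicGeometry.Resolution.PointBlowup
open Literature.AlgebraicGeometry.Resolution.Hauser2010
open Literature.Barriers.ResolutionOfSingularities (ordZero_le_of_coeff_ne_zero le_ordZero_of_forall)
open MohWindowShadeCleaning (eq_single_add_single degree_eq_add)

variable {σ : Type*} {K : Type*} [Field K] [Fintype σ] [DecidableEq σ] [DecidableEq K]
variable (p : ℕ) [hp : Fact p.Prime] [CharP K p]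

/-! ## §1. Origin runs (all dimensions) -/

omit hp [CharP K p] in
/-- **[OURS · L1 W4.6] At the origin of a chart a monomial survives with its coefficient.**  For a cleaned
residual polynomial all of whose monomials have degree `≥ p`, the coefficient of `y^{d^}`
(`d^ = chartExponent p c d`) in the residual polynomial after the blow-up read at the ORIGIN of the chart
`y_c` is the coefficient of `y^d`: nothing is translated, and `y^{d^}` is not a `p`-th power monomial
(else `y^d` would be one).  NOT a statement of the manuscript. [folklore] -/
theorem coeff_chartExponent_step_origin (c : σ) (s : State σ K)
    (hclean : deletePthPowers p s.F = s.F) (hdeg : ∀ d ∈ s.F.support, p ≤ d.degree) {d : σ →₀ ℕ}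
    (hd : d ∈ s.F.support) : coeff (chartExponent p c d) (step p c 0 s).F = coeff d s.F := by
  classical
  have hpt : pointTransform p c 0 s = chartTransform p c s.F := by
    unfold pointTransform; rw [translate_zero]
  have hcoeff : coeff (chartExponent p c d) (chartTransform p c s.F) = coeff d s.F := by
    unfold chartTransform
    rw [coeff_sum_monomial_of_injOn s.F.support (chartExponent p c) (fun d => coeff d s.F) hd]
    intro d' hd' _ h
    exact chartExponent_injective (hdeg d' hd') (hdeg d hd) h
  have hnot : ¬ IsPthPowerExponent p (chartExponent p c d) := by
    intro h
    apply not_isPthPowerExponent_of_clean p hclean hd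
    rw [isPthPowerExponent_iff] at h ⊢
    have hsum : p ∣ ∑ l ∈ univ.erase c, d l := by
      refine Finset.dvd_sum fun l hl => ?_
      have := h l
      rwa [chartExponent_apply, if_neg (Finset.ne_of_mem_erase hl)] at this
    have hdegd : p ∣ d.degree := by
      have hc := h c
      rw [chartExponent_apply, if_pos rfl] at hc
      have := dvd_add hc (dvd_refl p)
      rwa [Nat.sub_add_cancel (hdeg d hd)] at this
    intro l
    by_cases hlc : l = c
    · rw [hlc]
      rw [degree_eq_add_sum_erase c d] at hdegd
      exact (Nat.dvd_add_left hsum).mp hdegd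
    · have := h l
      rwa [chartExponent_apply, if_neg hlc] at this
  show coeff _ (deletePthPowers p (pointTransform p c 0 s)) = _
  rw [coeff_deletePthPowers, if_neg hnot, hpt, hcoeff]

omit hp [CharP K p] in
/-- **[OURS · L1 W4.6] AN INFINITE ORIGIN RUN IN ONE CHART FORCES A COORDINATE `p`-TH POWER (all
dimensions).**  Let `s₀, s₁, …` be states with `s_{n+1} = step p c 0 (s n)` — every blow-up read at the
ORIGIN of one and the same chart `y_c` (Hauser–Wagner's horizontal move for `c = rig`, vertical move for
`c = free`) — starting from a cleaned residual polynomial, and suppose every residual polynomial along the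
run has all its monomials of degree `≥ p` (the walk stays on `p`-fold points).  Then every monomial `y^d` of
`F₀` has `Σ_{l ≠ c} d_l ≥ p`: otherwise its images `y^{d^(n)}` survive with `|d^(n+1)| + p = |d^(n)| +
Σ_{l ≠ c} d_l < |d^(n)| + p`, a strictly decreasing sequence of degrees.  For two letters `{c, c'}`:
`y_{c'}^p ∣ F₀` — the start of the run lies on the coordinate `p`-fold curve `y_{c'} = 0`.  NOT a statement
of the manuscript. [folklore] -/
theorem forall_le_sum_of_origin_run (c : σ) (s : ℕ → State σ K)
    (hstep : ∀ n, s (n + 1) = step p c 0 (s n)) (hclean : deletePthPowers p (s 0).F = (s 0).F)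
    (hdeg : ∀ n, ∀ d ∈ (s n).F.support, p ≤ d.degree) :
    ∀ d ∈ (s 0).F.support, p ≤ ∑ l ∈ univ.erase c, d l := by
  classical
  have hcl : ∀ n, deletePthPowers p (s n).F = (s n).F := by
    intro n
    rcases n with _ | n
    · exact hclean
    · rw [hstep n]; exact deletePthPowers_step p c 0 (s n)
  intro d hd
  by_contra hlt
  push Not at hlt
  have hmem : ∀ n, (chartExponent p c)^[n] d ∈ (s n).F.support ∧
      ((chartExponent p c)^[n] d).degree + n ≤ d.degree ∧
      ∑ l ∈ univ.erase c, ((chartExponent p c)^[n] d) l = ∑ l ∈ univ.erase c, d l := by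
    intro n
    induction n with
    | zero => exact ⟨hd, by simp, rfl⟩
    | succ n ih =>
      obtain ⟨ih1, ih2, ih3⟩ := ih
      rw [Function.iterate_succ_apply', hstep n]
      refine ⟨?_, ?_, ?_⟩
      · rw [MvPolynomial.mem_support_iff,
          coeff_chartExponent_step_origin p c (s n) (hcl n) (hdeg n) ih1]
        exact MvPolynomial.mem_support_iff.mp ih1
      · have h1 := degree_chartExponent p c ((chartExponent p c)^[n] d)
        have h2 := degree_eq_add_sum_erase c ((chartExponent p c)^[n] d)
        have h3 := hdeg n _ ih1
        rw [ih3] at h2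
        omega
      · rw [← ih3]
        exact Finset.sum_congr rfl fun l hl => by
          rw [chartExponent_apply, if_neg (Finset.ne_of_mem_erase hl)]
  obtain ⟨-, h, -⟩ := hmem (d.degree + 1)
  omega

/-! ## §2. Surfaces: adapted states -/

section TwoLetters

variable {j i : σ}

omit [Fintype σ] [DecidableEq σ] [DecidableEq K] hp [CharP K p] in
/-- Root count: a non-zero polynomial divisible by `y^m` and by `(y − t)^n` with `t ≠ 0` has degree
`≥ m + n`. [folklore] -/
theorem add_le_natDegree_of_dvd {P : Polynomial K} (hP : P ≠ 0) {t : K} (ht : t ≠ 0) {m n : ℕ}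
    (h0 : Polynomial.X ^ m ∣ P) (ht' : (Polynomial.X - Polynomial.C t) ^ n ∣ P) :
    m + n ≤ P.natDegree := by
  classical
  have hm : m ≤ P.roots.count 0 := by
    rw [Polynomial.count_roots, Polynomial.le_rootMultiplicity_iff hP, map_zero, sub_zero]
    exact h0
  have hn : n ≤ P.roots.count t := by
    rw [Polynomial.count_roots, Polynomial.le_rootMultiplicity_iff hP]
    exact ht'
  have hle : Multiset.replicate m (0 : K) + Multiset.replicate n t ≤ P.roots := by
    rw [Multiset.le_iff_count]
    intro x
    rw [Multiset.count_add, Multiset.count_replicate, Multiset.count_replicate]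
    split_ifs with h1 h2 h2
    · exact absurd (h1.trans h2.symm) ht.symm
    · subst h1; simpa using hm
    · subst h2; simpa using hn
    · simp
  have h1 := Multiset.card_le_card hle
  rw [Multiset.card_add, Multiset.card_replicate, Multiset.card_replicate] at h1
  exact le_trans h1 (Polynomial.card_roots' P)

omit hp [CharP K p] in
/-- **[OURS · L1 W4.6] A stall at the ORIGIN of the chart `y_j` makes the next state adapted to `y_j`
(surfaces).**  Inside the window `p < o < 2p`, if the shade `a = o − |r|` does not drop at the origin of the
chart `y_j`, then the new residual polynomial contains the monomial `y^{r'} · y_i^{a}` (`r'` the new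
exceptional multiplicities): the image of THE initial monomial `y^r y_i^a` of `F` (gen 2's decrease law at
the origin pins the initial form of the residual factor to `c·y_i^a`).  NOT a statement of the manuscript.
[folklore] -/
theorem exists_adapted_of_stall_origin (hij : i ≠ j) (htwo : ∀ l, l = j ∨ l = i) (b : σ → K)
    (hb0 : ∀ l, b l = 0) (s : State σ K) (hclean : deletePthPowers p s.F = s.F) {o : ℕ}
    (ho : ordZero s.F = o) (hlo : p < o) (hhi : o < 2 * p) (hr : ∀ d ∈ s.F.support, s.r ≤ d)
    (hstall : ¬ ShadeDrops p j b s) :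
    ∃ E ∈ (step p j b s).F.support,
      E j = (step p j b s).r j ∧ E i = (step p j b s).r i + (o - s.r.degree) := by
  classical
  obtain ⟨⟨d₀, hd₀, hd₀deg⟩, -⟩ := (ordZero_eq_nat_iff _ _).mp ho
  have hd₀s : d₀ ∈ s.F.support := MvPolynomial.mem_support_iff.mpr hd₀
  obtain ⟨hj, hi⟩ := MohWindowShadeDecrease.initial_eq_of_not_shadeDrops_origin_two_vars p hij htwo b
    hb0 s ho hlo hhi hr hstall d₀ hd₀s hd₀deg
  have hb : b = 0 := funext hb0
  have hdeg : ∀ d ∈ s.F.support, p ≤ d.degree :=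
    fun d hd => le_trans hlo.le (le_degree_of_ordZero_eq s ho d hd)
  refine ⟨chartExponent p j d₀, ?_, ?_, ?_⟩
  · rw [hb, MvPolynomial.mem_support_iff, coeff_chartExponent_step_origin p j s hclean hdeg hd₀s]
    exact hd₀
  · rw [chartExponent_apply, if_pos rfl, MohWindowShadeTerminal.step_r_apply p j b (hb0 j) s ho j,
      if_pos (hb0 j), if_pos rfl, hd₀deg]
  · rw [chartExponent_apply, if_neg hij, MohWindowShadeTerminal.step_r_apply p j b (hb0 j) s ho i,
      if_pos (hb0 i), if_neg hij]
    have := Finsupp.le_def.mp (hr d₀ hd₀s) i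
    omega

omit hp [CharP K p] in
/-- **[OURS · L1 W4.6] From a state adapted to `y_j`, the vertical move drops the shade (surfaces).**
Inside the window, if the residual polynomial has an initial monomial `y^E` (`|E| = o`) whose `y_i`-exponent
exceeds `r_i` — e.g. the monomial `y^r y_i^a` of a state adapted to `y_j` with `a ≥ 1` — then at the origin
of the chart `y_i` the shade DROPS (gen 2's decrease law at the origin: a stall there would force every
initial monomial to have `y_i`-exponent exactly `r_i`).  So after a stall in the chart `y_j` the next stall,
if any, is again in the chart `y_j`.  NOT a statement of the manuscript. [folklore] -/
theorem shadeDrops_vertical_of_adapted (s : State σ K) {o : ℕ} (ho : ordZero s.F = o) (hlo : p < o)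
    (hhi : o < 2 * p) (hr : ∀ d ∈ s.F.support, s.r ≤ d) {E : σ →₀ ℕ} (hE : E ∈ s.F.support)
    (hEdeg : E.degree = o) (hEi : s.r i < E i) : ShadeDrops p i (0 : σ → K) s := by
  by_contra hstall
  have h := MohWindowShadeDecrease.forall_initial_apply_eq_of_not_shadeDrops_origin p i (0 : σ → K)
    (fun _ => rfl) s ho hlo hhi hr hstall E hE hEdeg
  omega

omit [Fintype σ] [DecidableEq σ] [DecidableEq K] hp [CharP K p] in
/-- The `k`-th Taylor coefficient at `t` of `Σ_x c_x y^{n_x}` is `Σ_x c_x · C(n_x, k) · t^{n_x − k}` (the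
Hasse coefficient of the Hasse test). [folklore] -/
theorem taylor_coeff_sum_C_mul_X_pow {ι : Type*} (S : Finset ι) (c : ι → K) (n : ι → ℕ) (t : K)
    (k : ℕ) :
    (Polynomial.taylor t (∑ x ∈ S, Polynomial.C (c x) * Polynomial.X ^ (n x))).coeff k =
      ∑ x ∈ S, c x * (((n x).choose k : K) * t ^ (n x - k)) := by
  rw [map_sum, Polynomial.finsetSum_coeff]
  refine Finset.sum_congr rfl fun x _ => ?_
  rw [Polynomial.taylor_mul, Polynomial.taylor_C, Polynomial.taylor_X_pow, Polynomial.coeff_C_mul,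
    Polynomial.coeff_X_add_C_pow]
  ring

omit hp [CharP K p] in
/-- **[OURS · L1 W4.6] A stall at a TRANSLATED point of the chart `y_j` makes the next state adapted to
`y_j` (surfaces).**  Inside the window `p < o < 2p`, at the translated point `b = t·e_i` (`t ≠ 0`) of the
chart `y_j`: if the shade `a = o − |r|` does not drop, then the new residual polynomial contains the
monomial `y_j^{o−p} · y_i^{a} = y^{r'} y_i^a` (the new multiplicities being `r' = (o − p)·e_j`, the
component `y_i` lost).  Proof: by gen 2's Hasse test the Hasse coefficients `λ_k(t)`, `k < a`, of the
dehomogenised initial form `P(y) = Σ_{|d| = o} c_d y^{d_i}` vanish at a stall; if `λ_a(t)` vanished too,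
`(y − t)^{a+1}` and `y^{r_i}` would both divide `P ≠ 0`, of degree `≤ r_i + a` — too many roots; and
`λ_a(t)` is the coefficient of `y_j^{o−p} y_i^a`, which survives the cleaning (`0 < o − p < p`).  NOT a
statement of the manuscript. [folklore] -/
theorem mem_support_step_of_stall_translate (hij : i ≠ j) (htwo : ∀ l, l = j ∨ l = i) (b : σ → K)
    (hbj : b j = 0) (hbi : b i ≠ 0) (s : State σ K) {o : ℕ} (ho : ordZero s.F = o) (hlo : p < o)
    (hhi : o < 2 * p) (hr : ∀ d ∈ s.F.support, s.r ≤ d) (hstall : ¬ ShadeDrops p j b s) :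
    Finsupp.single j (o - p) + Finsupp.single i (o - s.r.degree) ∈ (step p j b s).F.support := by
  classical
  obtain ⟨⟨d₀, hd₀, hd₀deg⟩, -⟩ := (ordZero_eq_nat_iff _ _).mp ho
  have hd₀s : d₀ ∈ s.F.support := MvPolynomial.mem_support_iff.mpr hd₀
  have hdeg := le_degree_of_ordZero_eq s ho
  set a := o - s.r.degree with ha
  -- the Hasse coefficients `λ_k(t)`
  set lam : ℕ → K := fun k =>
    ∑ d ∈ s.F.support with d.degree = o, coeff d s.F * (((d i).choose k : K) * b i ^ (d i - k)) with hlam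
  -- Step 1: `λ_k = 0` for `k < a`
  have hvan : ∀ k, k < a → lam k = 0 := by
    intro k hk
    by_contra hne
    have h := MohWindowShadeHasse.shade_step_le_of_hasse_ne_zero_two_vars p hij htwo b hbj hbi s ho
      hlo hhi k hne
    apply hstall
    show (step p j b s).shade < s.shade
    rw [shade_eq_of_ordZero_eq s ho]
    exact lt_of_le_of_lt h (by exact_mod_cast hk)
  -- Step 2: `λ_a ≠ 0` by counting roots of the dehomogenised initial form
  have hne : lam a ≠ 0 := by
    intro hzero
    set P : Polynomial K :=
      ∑ d ∈ s.F.support with d.degree = o, Polynomial.C (coeff d s.F) * Polynomial.X ^ (d i) with hP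
    have htaylor : ∀ k, k ≤ a → (Polynomial.taylor (b i) P).coeff k = 0 := by
      intro k hk
      rw [hP, taylor_coeff_sum_C_mul_X_pow]
      rcases hk.lt_or_eq with h | h
      · exact hvan k h
      · rw [h]; exact hzero
    -- `P ≠ 0`, `y^{r_i} ∣ P`, `deg P ≤ r_i + a`
    have hPne : P ≠ 0 := by
      intro h0
      have hc : P.coeff (d₀ i) = coeff d₀ s.F := by
        rw [hP, Polynomial.finsetSum_coeff, Finset.sum_eq_single d₀]
        · rw [Polynomial.coeff_C_mul_X_pow, if_pos rfl]
        · intro d hd hne'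
          rw [Polynomial.coeff_C_mul_X_pow, if_neg]
          intro heq
          apply hne'
          obtain ⟨-, hdo⟩ := Finset.mem_filter.mp hd
          have h1 := degree_eq_add hij htwo d
          have h2 := degree_eq_add hij htwo d₀
          have hdj : d j = d₀ j := by omega
          rw [eq_single_add_single hij htwo d, eq_single_add_single hij htwo d₀, hdj, heq]
        · intro h; exact absurd (Finset.mem_filter.mpr ⟨hd₀s, hd₀deg⟩) h
      rw [h0, Polynomial.coeff_zero] at hc
      exact hd₀ hc.symm
    have hX0 : Polynomial.X ^ (s.r i) ∣ P := by
      rw [hP]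
      refine Finset.dvd_sum fun d hd => ?_
      obtain ⟨hds, -⟩ := Finset.mem_filter.mp hd
      exact dvd_mul_of_dvd_right (pow_dvd_pow _ (Finsupp.le_def.mp (hr d hds) i)) _
    have hdegP : P.natDegree ≤ s.r i + a := by
      rw [hP]
      refine Polynomial.natDegree_sum_le_of_forall_le _ _ fun d hd => ?_
      refine le_trans (Polynomial.natDegree_C_mul_X_pow_le _ _) ?_
      obtain ⟨hds, hdo⟩ := Finset.mem_filter.mp hd
      have h1 := degree_eq_add hij htwo d
      have h2 := degree_eq_add hij htwo s.r
      have h3 : s.r j ≤ d j := Finsupp.le_def.mp (hr d hds) j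
      have h4 : s.r.degree ≤ o := hd₀deg ▸ degree_le_degree_of_le (hr d₀ hd₀s)
      omega
    -- `(y − t)^{a+1} ∣ P`
    have hXt : (Polynomial.X - Polynomial.C (b i)) ^ (a + 1) ∣ P := by
      have hX : Polynomial.X ^ (a + 1) ∣ Polynomial.taylor (b i) P :=
        Polynomial.X_pow_dvd_iff.mpr fun k hk => htaylor k (by omega)
      obtain ⟨Q, hQ⟩ := hX
      have hback : P = Polynomial.taylor (-b i) (Polynomial.taylor (b i) P) := by
        rw [Polynomial.taylor_taylor, neg_add_cancel, Polynomial.taylor_zero]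
      rw [hback, hQ, Polynomial.taylor_mul, Polynomial.taylor_X_pow, map_neg, ← sub_eq_add_neg]
      exact dvd_mul_right _ _
    have h := add_le_natDegree_of_dvd hPne hbi hX0 hXt
    omega
  -- Step 3: `λ_a` is the coefficient of `y_j^{o−p} y_i^{a}`, which survives the cleaning
  set E : σ →₀ ℕ := Finsupp.single j (o - p) + Finsupp.single i a with hE
  have hEj : E j = o - p := by
    rw [hE, Finsupp.add_apply, Finsupp.single_eq_same, Finsupp.single_eq_of_ne hij.symm, add_zero]
  have hEi : E i = a := by
    rw [hE, Finsupp.add_apply, Finsupp.single_eq_of_ne hij, Finsupp.single_eq_same, zero_add]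
  have herase : (Finset.univ : Finset σ).erase j = {i} := by
    ext l
    rw [Finset.mem_erase, Finset.mem_singleton]
    constructor
    · rintro ⟨hlj, -⟩
      rcases htwo l with h | h
      · exact absurd h hlj
      · exact h
    · intro h; rw [h]; exact ⟨hij, Finset.mem_univ i⟩
  have hnot : ¬ IsPthPowerExponent p E := by
    intro h
    have h1 : p ∣ E j := (isPthPowerExponent_iff p E).mp h j
    rw [hEj] at h1
    have h2 : 0 < o - p := by omega
    have := Nat.le_of_dvd h2 h1
    omega
  rw [MvPolynomial.mem_support_iff]
  show coeff E (deletePthPowers p (pointTransform p j b s)) ≠ 0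
  rw [coeff_deletePthPowers, if_neg hnot,
    MohWindowShadeHasse.coeff_pointTransform_layer p j b hbj s ho hlo.le E hEj]
  have hprod : ∀ d : σ →₀ ℕ, ∏ l ∈ univ.erase j, (((d l).choose (E l) : K) * b l ^ (d l - E l))
      = ((d i).choose a : K) * b i ^ (d i - a) := fun d => by
    rw [herase, Finset.prod_singleton, hEi]
  simp_rw [hprod]
  exact hne

end TwoLetters

end Summit.ResolutionOfSingularities.ResolutionOfSingularities.Theorems.CampaignW46.MohWindowShadeAdapted
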